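import Mathlib.Analysis.SpecialFunctions.Complex.Arg
import Literature.Analysis.FluidPDE.AxisymmetricVorticityTransport
import HarnessLib

/-!
# Axisymmetry without swirl as equivariance under the full symmetry group of the axis

Analysis/FluidPDE support file (symmetry bookkeeping for the global regularity theorem of
Ladyzhenskaya and Ukhovskii–Yudovich for axisymmetric Navier–Stokes flows without swirl,
`Literature.Analysis.FluidPDE.axisymmetric_no_swirl_global_regularity`, `Axisymmetric.lean`).

The accepted vocabulary (`AxisymmetricEuler.lean`; Koch–Nadirashvili–Seregin–Šverák 2009, §5, p. 9)
defines a field `u : ℝ³ → ℝ³` to be *axisymmetric* if `u (R_θ x) = R_θ (u x)` for every rotation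
`R_θ = rotZ θ` about the `x₂`-axis (`IsAxisymmetric`), and to have *no swirl* if
`Γ = x₀ u₁ − x₁ u₀ ≡ 0` (`HasNoSwirl`). This file records the elementary group-theoretic
reformulation used to propagate both properties along the Navier–Stokes flow *by uniqueness
alone* (rotation/reflection covariance of the equations, `IsometryInvariance.lean`, plus a
uniqueness theorem): the isometry group of `ℝ³` fixing the axis pointwise-as-a-line is
`O(2) = SO(2) ⋊ ℤ/2`, generated by the rotations `R_θ` and one reflection in a meridian plane,
here `σ (x₀, x₁, x₂) = (x₀, −x₁, x₂)` (`reflY`), and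

* `u` is axisymmetric iff it is equivariant under every `R_θ`
  (`isAxisymmetric_iff_conj_rotZLIE`, the definition rewritten with the tree's packaging of the
  rotations as linear isometry equivalences `rotZLIE θ : ℝ³ ≃ₗᵢ[ℝ] ℝ³`,
  `AxisymmetricVorticityTransport.lean`);
* an axisymmetric `u` has no swirl iff it is moreover equivariant under `σ`,
  `u (σ x) = σ (u x)` (`IsAxisymmetric.hasNoSwirl_iff_reflY`): at `x = (r cos α, r sin α, z)` one
  has `σ x = R_{−2α} x`, so `Γ(σ x) = Γ(x)` by axisymmetry while `Γ(σ x) = −Γ(x)` by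
  `σ`-equivariance; conversely `Γ = 0` means `(u₀, u₁) ∥ (x₀, x₁)`, and then
  `R_{−2α} (u x) = σ (u x)`.

This is the classical remark that "axisymmetric without swirl" is the symmetry class of the
full group `O(2)` (Majda–Bertozzi 2002, §2.3.3: axisymmetric flows without swirl are the flows
`v = vʳ(r, x₃, t) e_r + v³(r, x₃, t) e₃`, eqs. (2.52)–(2.53); Lemarié-Rieusset 2016, §10.3, p. 282:
"the swirl of the vector field is the component `V_θ`"; (10.20)–(10.21), p. 284: no swirl is
preserved, derived there from the swirl equation rather than from `O(2)`-equivariance). No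
analysis is involved; everything here is proved.

## Main statements

* `reflY`: the meridian reflection as a linear isometry equivalence of
  `ℝ³ = EuclideanSpace ℝ (Fin 3)` (for use with `IsClassicalNSSolutionOn.conj_linearIsometryEquiv`,
  next to the tree's rotations `rotZLIE θ`).
* `isAxisymmetric_iff_conj_rotZLIE` (its `→` direction is the tree's
  `IsAxisymmetric.rotZ_apply_rotZ_neg`).
* `IsAxisymmetric.hasNoSwirl_iff_reflY`, `IsAxisymmetric.conj_reflY_eq`,
  `IsAxisymmetric.hasNoSwirl_of_conj_reflY_eq`.

## Mathlib / tree search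

`lean search 'rotZ|rotZLIE|reflY|reflection'`: the tree has `rotZ` with `rotZ_add`,
`rotZ_zero`, `norm_rotZ`, `rotZ_pi`, `IsAxisymmetric.swirl_rotZ` (`AxisymmetricEuler`,
`KNSSAxisymmetricNoSwirl`) and the packaged rotations `rotZLinearEquiv`, `rotZLIE`,
`rotZLIE_apply`, `rotZLIE_symm_apply`, `IsAxisymmetric.rotZ_apply_rotZ_neg`
(`AxisymmetricVorticityTransport`), which are reused here (hence the import). The tree also has
the coordinate reflections `reflC (i : Fin 3) : ℝ³ →L[ℝ] ℝ³` (`AxisymmetricLiftR5.lean`, on the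
KNSS §5 path), of which `reflC 1` is *the same map* `x ↦ (x₀, −x₁, x₂)` as `reflY` below, with
`reflC_reflC`, `reflC_eq_self`, `cylRadius_reflC_one` (counterparts of `reflY_reflY`,
`cylRadius_reflY`); `reflY` is its packaging as a linear **isometry equivalence** (the form
consumed by `IsClassicalNSSolutionOn.conj_linearIsometryEquiv`), kept import-light here (no
import of the `ℝ⁵`-lift file) so that a librarian can later merge the two (bridge:
`reflY x = reflC 1 x` for every `x`, immediate from `reflC_apply`). The polar-angle lemma
`exists_rotZ_eq_single_add_smul` (`KNSSTypeIRateSelection.lean`) is the rotation onto the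
meridian half-plane; `exists_rotZ_eq_reflY` below is the rotation onto the mirror image.
Mathlib: `LinearIsometryEquiv`, `Submodule.reflection` (the abstract form; cf.
`Literature.Topology.FourManifolds.MorseBirth.coordReflection`, not imported cross-topic),
`Complex.arg`, `Complex.cos_arg`, `Complex.sin_arg` (an angle with prescribed cosine and sine).

## References

* G. Koch, N. Nadirashvili, G. Seregin, V. Šverák, *Liouville theorems for the Navier–Stokes
  equations and applications*, Acta Math. 203 (2009) = arXiv:0709.3599, §5, p. 9 (definition of
  axi-symmetry, `u(Rx) = Ru(x)`, right after Thm. 5.1). [KochNadirashviliSereginSverak2009]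
* A. J. Majda, A. L. Bertozzi, *Vorticity and Incompressible Flow*, CUP 2002, §2.3.3, (2.52)–(2.53).
* P. G. Lemarié-Rieusset, *The Navier–Stokes Problem in the 21st Century*, CRC Press 2016,
  §10.3, p. 282 and (10.20)–(10.21). [LemarieRieusset2016]
-/

noncomputable section

open Set Function WithLp

namespace Literature.Analysis.FluidPDE

/-- Local notation for physical space `ℝ³ = EuclideanSpace ℝ (Fin 3)`. -/
local notation "ℝ³" => EuclideanSpace ℝ (Fin 3)

/-! ### Axisymmetry as equivariance under the packaged rotations `rotZLIE` -/

/-- **Axisymmetry is equivariance under the rotations about the axis**, in conjugation form: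
`u` is axisymmetric iff `R_θ (u (R_θ⁻¹ x)) = u x` for all `θ`, `x`, with the tree's linear
isometry equivalences `rotZLIE θ` (KNSS 2009, §5, p. 9: "`u(Rx) = Ru(x)` for every rotation
`R`"; the `→` direction is `IsAxisymmetric.rotZ_apply_rotZ_neg`). [cite: KochNadirashviliSereginSverak2009, §5, p. 9 (definition of axi-symmetry)] -/
theorem isAxisymmetric_iff_conj_rotZLIE (u : ℝ³ → ℝ³) :
    IsAxisymmetric u ↔ ∀ θ x, rotZLIE θ (u ((rotZLIE θ).symm x)) = u x := by
  constructor
  · intro hu θ x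
    rw [rotZLIE_apply, rotZLIE_symm_apply]
    exact hu.rotZ_apply_rotZ_neg θ x
  · intro h θ x
    have e := h θ (rotZLIE θ x)
    rw [LinearIsometryEquiv.symm_apply_apply] at e
    exact e.symm

/-! ### The reflection in the meridian plane `{x₁ = 0}` -/

/-- The reflection `σ (x₀, x₁, x₂) = (x₀, −x₁, x₂)` in the meridian plane `{x₁ = 0}` (a plane
containing the axis of symmetry), as a linear isometry equivalence of `ℝ³`; together with the
rotations `R_θ` it generates the group `O(2)` of isometries preserving the axis and its
orientation (Majda–Bertozzi 2002, §2.3.3); the rotations themselves are the tree's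
`rotZLIE θ`. This is the isometry-equivalence packaging of the tree's continuous linear map
`reflC 1` (`AxisymmetricLiftR5.lean`; same map, `reflY x = reflC 1 x`), kept import-light so the
two can be merged later. [folklore] -/
def reflY : ℝ³ ≃ₗᵢ[ℝ] ℝ³ where
  toFun x := toLp 2 ![x 0, -x 1, x 2]
  invFun x := toLp 2 ![x 0, -x 1, x 2]
  map_add' y z := by
    ext i; fin_cases i <;> simp; ring
  map_smul' c y := by
    ext i; fin_cases i <;> simp
  left_inv y := by
    ext i; fin_cases i <;> simp
  right_inv y := by
    ext i; fin_cases i <;> simp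
  norm_map' x := by
    rw [EuclideanSpace.norm_eq, EuclideanSpace.norm_eq]
    congr 1
    simp [Fin.sum_univ_three]

/-- First component: `(σ x)₀ = x₀`. [folklore] -/
@[simp] theorem reflY_apply_zero (x : ℝ³) : reflY x 0 = x 0 := rfl

/-- Second component: `(σ x)₁ = −x₁`. [folklore] -/
@[simp] theorem reflY_apply_one (x : ℝ³) : reflY x 1 = -x 1 := rfl

/-- Third component: `(σ x)₂ = x₂` (the axis lies in the mirror). [folklore] -/
@[simp] theorem reflY_apply_two (x : ℝ³) : reflY x 2 = x 2 := rfl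

/-- `σ` is an involution. [folklore] -/
@[simp] theorem reflY_reflY (x : ℝ³) : reflY (reflY x) = x := by
  ext i; fin_cases i <;> simp

/-- `σ⁻¹ = σ`. [folklore] -/
@[simp] theorem reflY_symm : reflY.symm = reflY := rfl

/-- The mirror contains the axis: `σ` preserves the distance to the axis. [folklore] -/
theorem cylRadius_reflY (x : ℝ³) : cylRadius (reflY x) = cylRadius x := by
  simp [cylRadius]

/-- The swirl changes sign under the reflection of both the point and the vector:
`Γ_{σ ∘ u ∘ σ} (σ x) = −Γ_u (x)`, i.e. `(σ x)₀ (σ v)₁ − (σ x)₁ (σ v)₀ = −(x₀ v₁ − x₁ v₀)`. [folklore] -/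
theorem swirl_reflY_conj (u : ℝ³ → ℝ³) (x : ℝ³) :
    swirl (fun y => reflY (u (reflY y))) (reflY x) = -swirl u x := by
  simp [swirl, reflY_reflY]
  ring

/-- An angle with prescribed cosine and sine on the unit circle (via `Complex.arg`). [folklore] -/
theorem exists_cos_eq_sin_eq {c s : ℝ} (h : c ^ 2 + s ^ 2 = 1) :
    ∃ θ : ℝ, Real.cos θ = c ∧ Real.sin θ = s := by
  set z : ℂ := ⟨c, s⟩ with hz
  have hnorm : ‖z‖ = 1 := by
    rw [Complex.norm_def, Complex.normSq_mk]
    rw [show c * c + s * s = 1 by nlinarith [h]]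
    exact Real.sqrt_one
  have hz0 : z ≠ 0 := by
    intro h0
    rw [h0, norm_zero] at hnorm
    exact zero_ne_one hnorm
  refine ⟨Complex.arg z, ?_, ?_⟩
  · rw [Complex.cos_arg hz0, hnorm, div_one]
  · rw [Complex.sin_arg, hnorm, div_one]

/-- **Off the axis, the mirror image of a point is a rotate of it**: for `x` with `r ≠ 0` there
is an angle `θ` (namely `−2α` if `(x₀, x₁) = r (cos α, sin α)`) with `R_θ x = σ x`; explicitly
`cos θ = (x₀² − x₁²)/r²`, `sin θ = −2 x₀ x₁ / r²`. [folklore] -/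
theorem exists_rotZ_eq_reflY {x : ℝ³} (hx : cylRadius x ≠ 0) :
    ∃ θ : ℝ, Real.cos θ = (x 0 ^ 2 - x 1 ^ 2) / cylRadius x ^ 2 ∧
      Real.sin θ = -(2 * x 0 * x 1) / cylRadius x ^ 2 ∧ rotZ θ x = reflY x := by
  have hr2 : cylRadius x ^ 2 = x 0 ^ 2 + x 1 ^ 2 := cylRadius_sq x
  have hr0 : cylRadius x ^ 2 ≠ 0 := pow_ne_zero 2 hx
  obtain ⟨θ, hc, hs⟩ := exists_cos_eq_sin_eq (c := (x 0 ^ 2 - x 1 ^ 2) / cylRadius x ^ 2)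
    (s := -(2 * x 0 * x 1) / cylRadius x ^ 2) (by
      rw [div_pow, div_pow, ← add_div, div_eq_one_iff_eq (pow_ne_zero 2 hr0), hr2]
      ring)
  refine ⟨θ, hc, hs, ?_⟩
  ext i
  fin_cases i
  · simp only [Fin.zero_eta, rotZ_apply_zero, reflY_apply_zero, hc, hs]
    rw [div_mul_eq_mul_div, div_mul_eq_mul_div, ← sub_div, div_eq_iff hr0, hr2]
    ring
  · simp only [Fin.mk_one, rotZ_apply_one, reflY_apply_one, hc, hs]
    rw [div_mul_eq_mul_div, div_mul_eq_mul_div, ← add_div, div_eq_iff hr0, hr2]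
    ring
  · simp

/-- On the axis an axisymmetric field is vertical: if `r(x) = 0` then `u x = (0, 0, u₂ x)`, in
particular `σ (u x) = u x` (the point `x` is fixed by every `R_θ`, so `u x = R_π (u x)`). [folklore] -/
theorem IsAxisymmetric.horizontal_eq_zero_of_cylRadius_eq_zero {u : ℝ³ → ℝ³}
    (hu : IsAxisymmetric u) {x : ℝ³} (hx : cylRadius x = 0) : u x 0 = 0 ∧ u x 1 = 0 := by
  obtain ⟨h0, h1⟩ := (cylRadius_eq_zero_iff x).1 hx
  have hfix : rotZ Real.pi x = x := by
    ext i; fin_cases i <;> simp [h0, h1]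
  have e := hu Real.pi x
  rw [hfix] at e
  -- `e : u x = rotZ π (u x)`, i.e. `(u₀, u₁) = (−u₀, −u₁)`
  have e0 := congrFun (congrArg (fun v : ℝ³ => (v : Fin 3 → ℝ)) e) 0
  have e1 := congrFun (congrArg (fun v : ℝ³ => (v : Fin 3 → ℝ)) e) 1
  simp [Real.cos_pi, Real.sin_pi] at e0 e1
  constructor <;> linarith

/-- **An axisymmetric field without swirl is equivariant under the meridian reflection**:
`u (σ x) = σ (u x)`. Off the axis, `σ x = R_θ x` with `cos θ = (x₀² − x₁²)/r²`,
`sin θ = −2x₀x₁/r²`, so `u (σ x) = R_θ (u x)`, and `Γ = x₀u₁ − x₁u₀ = 0` gives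
`R_θ (u x) = σ (u x)`; on the axis both sides equal the vertical vector `u x`
(Majda–Bertozzi 2002, §2.3.3, (2.52)–(2.53): swirl-free axisymmetric fields are
`vʳ(r, z) e_r + v³(r, z) e₃`). [cite: MajdaBertozziCUP2002, §2.3.3 (2.52)–(2.53)] -/
theorem IsAxisymmetric.reflY_eq_of_hasNoSwirl {u : ℝ³ → ℝ³} (hu : IsAxisymmetric u)
    (hsw : HasNoSwirl u) (x : ℝ³) : u (reflY x) = reflY (u x) := by
  by_cases hx : cylRadius x = 0
  · obtain ⟨h0, h1⟩ := (cylRadius_eq_zero_iff x).1 hx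
    obtain ⟨hu0, hu1⟩ := hu.horizontal_eq_zero_of_cylRadius_eq_zero hx
    have hfix : reflY x = x := by
      ext i; fin_cases i <;> simp [h1]
    rw [hfix]
    ext i; fin_cases i <;> simp [hu1]
  · obtain ⟨θ, hc, hs, hrot⟩ := exists_rotZ_eq_reflY hx
    have hr2 : cylRadius x ^ 2 = x 0 ^ 2 + x 1 ^ 2 := cylRadius_sq x
    have hr0 : cylRadius x ^ 2 ≠ 0 := pow_ne_zero 2 hx
    have hΓ : x 0 * u x 1 - x 1 * u x 0 = 0 := hsw x
    rw [← hrot, hu θ x]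
    ext i
    fin_cases i
    · simp only [Fin.zero_eta, rotZ_apply_zero, reflY_apply_zero, hc, hs]
      rw [div_mul_eq_mul_div, div_mul_eq_mul_div, ← sub_div, div_eq_iff hr0, hr2]
      linear_combination (2 * x 1) * hΓ
    · simp only [Fin.mk_one, rotZ_apply_one, reflY_apply_one, hc, hs]
      rw [div_mul_eq_mul_div, div_mul_eq_mul_div, ← add_div, div_eq_iff hr0, hr2]
      linear_combination (2 * x 0) * hΓ
    · simp

/-- **A field which is axisymmetric and equivariant under the meridian reflection has no
swirl**: off the axis `σ x = R_θ x`, so `Γ(σ x) = Γ(x)` by axisymmetry of the swirl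
(`IsAxisymmetric.swirl_rotZ`), while `σ`-equivariance gives `Γ(σ x) = −Γ(x)`
(`swirl_reflY_conj`); on the axis `Γ = 0` always. [cite: MajdaBertozziCUP2002, §2.3.3 (2.52)–(2.53)] -/
theorem IsAxisymmetric.hasNoSwirl_of_reflY_eq {u : ℝ³ → ℝ³} (hu : IsAxisymmetric u)
    (hσ : ∀ x, u (reflY x) = reflY (u x)) : HasNoSwirl u := by
  intro x
  by_cases hx : cylRadius x = 0
  · exact swirl_eq_zero_of_cylRadius_eq_zero u hx
  · obtain ⟨θ, -, -, hrot⟩ := exists_rotZ_eq_reflY hx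
    -- `Γ(σ x) = Γ(x)` by axisymmetry
    have h1 : swirl u (reflY x) = swirl u x := by rw [← hrot, hu.swirl_rotZ]
    -- `Γ(σ x) = −Γ(x)` by `σ`-equivariance
    have hconj : (fun y => reflY (u (reflY y))) = u := by
      funext y
      rw [hσ y, reflY_reflY]
    have h2 : swirl u (reflY x) = -swirl u x := by
      have := swirl_reflY_conj u x
      rwa [hconj] at this
    linarith

/-- **Axisymmetric fields: no swirl iff equivariant under the meridian reflection**
(`reflY_eq_of_hasNoSwirl`, `hasNoSwirl_of_reflY_eq`). Hence "axisymmetric without swirl" is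
exactly equivariance under the group `O(2)` generated by the `R_θ` and `σ`, a form in which
both properties can be propagated by any uniqueness theorem for a rotation- and
reflection-covariant evolution (cf. Lemarié-Rieusset 2016, p. 282 for the definition of the
swirl and (10.20)–(10.21), p. 284, for the preservation of no swirl, obtained there from the
swirl equation instead; Majda–Bertozzi 2002, §2.3.3 (2.52)–(2.53)). [cite: MajdaBertozziCUP2002, §2.3.3 (2.52)–(2.53)] -/
theorem IsAxisymmetric.hasNoSwirl_iff_reflY {u : ℝ³ → ℝ³} (hu : IsAxisymmetric u) :
    HasNoSwirl u ↔ ∀ x, u (reflY x) = reflY (u x) :=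
  ⟨fun h x => hu.reflY_eq_of_hasNoSwirl h x, fun h => hu.hasNoSwirl_of_reflY_eq h⟩

/-- Conjugation form: an axisymmetric field without swirl is fixed by conjugation with the
meridian reflection, `σ (u (σ⁻¹ x)) = u x`. [cite: MajdaBertozziCUP2002, §2.3.3 (2.52)–(2.53)] -/
theorem IsAxisymmetric.conj_reflY_eq {u : ℝ³ → ℝ³} (hu : IsAxisymmetric u) (hsw : HasNoSwirl u)
    (x : ℝ³) : reflY (u (reflY.symm x)) = u x := by
  rw [reflY_symm, hu.reflY_eq_of_hasNoSwirl hsw, reflY_reflY]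

/-- Converse conjugation form: an axisymmetric field fixed by conjugation with the meridian
reflection has no swirl. [cite: MajdaBertozziCUP2002, §2.3.3 (2.52)–(2.53)] -/
theorem IsAxisymmetric.hasNoSwirl_of_conj_reflY_eq {u : ℝ³ → ℝ³} (hu : IsAxisymmetric u)
    (h : ∀ x, reflY (u (reflY.symm x)) = u x) : HasNoSwirl u := by
  refine hu.hasNoSwirl_of_reflY_eq fun x => ?_
  have e := h (reflY x)
  rw [reflY_symm, reflY_reflY] at e
  exact e.symm

end Literature.Analysis.FluidPDE

end
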